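import Literature.Analysis.FluidPDE.MildSolution
import Literature.Analysis.FluidPDE.OseenHeat
import HarnessLib

/-!
# The heat-smoothed divergence of a tensor product `e^{σΔ} div (v ⊗ w)` in `Lᵖ`

Analysis/FluidPDE support file (theorem-only) for the discharge of the named fact
`Literature.Analysis.FluidPDE.isMildNSSolutionOn_iff_duhamel_two` (`MildSolution.lean`;
Lemarié-Rieusset 2002, Thm. 11.2 = Lemarié-Rieusset 2016, Thm. 6.1: duality form ⇔ `L²` Duhamel
formula). The accepted `Literature.Analysis.FluidPDE.heatDivTensor σ v w x = ∫ (D G_σ)(x - y)[v y] • w y dy`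
(`G_σ` the Gauss–Weierstrass kernel) is the Duhamel integrand `e^{σΔ} div (v ⊗ w)` of Kato 1984,
(1.7). This file provides its `Lᵖ` theory for bounded `v` and `w ∈ Lᵖ`:

* `Literature.Analysis.FluidPDE.eLpNorm_heatDivTensor_le`, `memLp_heatDivTensor` (**Young bound**):
  `‖e^{σΔ} div (v ⊗ w)‖_p ≤ C 2^{n/2} σ^{-1/2} ‖w‖_p` when `|v| ≤ C` a.e. (`1 ≤ p < ∞`), from the
  pointwise bound `|heatDivTensor σ v w (x)| ≤ C ∫ |∇G_σ(x - y)| |w(y)| dy`, the `lintegral` form of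
  Young's inequality `L¹ × Lᵖ → Lᵖ` (`lintegral_rpow_lintegral_sub_mul_le`) and the tree's
  `‖∇G_σ‖₁ ≤ 2^{n/2} σ^{-1/2}` (`lintegral_enorm_fderiv_heatKernel_le`).
* `Literature.Analysis.FluidPDE.integral_inner_heatDivTensor_eq` (**pairing identity**): for
  `φ, w ∈ L²`, `∫ ⟪e^{σΔ} div (v ⊗ w), φ⟫ = -∫ ⟪w, (v·∇) e^{σΔ} φ⟫` (Fubini on `E × E`, the derivative
  of the caloric extension as the convolution with the odd kernel `∇G_σ`,
  `fderiv_heatExtension_apply_eq_convolution`): the tested form of `e^{σΔ} div (v ⊗ w)` used by the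
  duality ("very weak") formulation of mild solutions (Fabes–Jones–Rivière 1972, Thm. 2.1).
* `Literature.Analysis.FluidPDE.aestronglyMeasurable_heatDivTensor_param` (**joint measurability**
  in a parameter): for jointly measurable data `V, W : P × E → ·` and measurable times `c`,
  `(p, x) ↦ heatDivTensor (c p) V(p, ·) W(p, ·) x` is a.e. strongly measurable on `P × E`.

## Mathlib / tree search

Tree (accepted, proved): `heatDivTensor` (`MildSolution`), `fderiv_heatKernel_apply_eq_mul_inner`,
`fderiv_heatKernel_neg_apply`, `integrable_fderiv_heatKernel_apply`, `memLp_fderiv_heatKernel_apply`,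
`fderiv_heatExtension_apply_eq_convolution`, `integrable_kernel_mul_mul` (`HeatFlowCalculus`),
`lintegral_enorm_fderiv_heatKernel_le`, `norm_fderiv_heatKernel_le`, `memLp_gaussian_of_pos`
(`HeatKernelGradient`), `quasiMeasurePreserving_proj_param` (`OseenHeat`). Not in the tree before
(`lean search 'heatDivTensor'`: only the definition and two docstring mentions): any estimate or
identity for `heatDivTensor`. Mathlib: `enorm_integral_le_lintegral_enorm`,
`lintegral_lintegral_swap`, `integral_integral_swap`, `integral_inner`,
`AEStronglyMeasurable.integral_prod_right'`.

## References

* T. Kato, *Strong `Lᵖ`-solutions of the Navier–Stokes equation in `ℝᵐ`*, Math. Z. 187 (1984)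
  471–480, (1.7), (2.3').
* P. G. Lemarié-Rieusset, *The Navier–Stokes Problem in the 21st Century*, CRC Press 2016,
  §6.2 (heat kernel calculus), Thm. 6.1 (Oseen's equations). Bib key `LemarieRieusset2016`.
* E. B. Fabes, B. F. Jones, N. M. Rivière, Arch. Rational Mech. Anal. 45 (1972), Thm. 2.1.
* M.-H. Giga, Y. Giga, J. Saal, *Nonlinear PDEs*, Birkhäuser 2010, §1.1.3 (`‖∇e^{tΔ}f‖_p`).
-/

noncomputable section

open MeasureTheory TopologicalSpace Set Function Filter Topology InnerProductSpace
open scoped RealInnerProductSpace ENNReal NNReal Convolution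

namespace Literature.Analysis.FluidPDE

/-! ### Young's inequality `L¹ × Lᵖ → Lᵖ` in `lintegral` form for a difference kernel -/

section Young

variable {E : Type*} [NormedAddCommGroup E] [MeasurableSpace E] [BorelSpace E]
  [SecondCountableTopology E] {μ : Measure E} [SFinite μ] [μ.IsAddLeftInvariant]
  [μ.IsAddRightInvariant] [μ.IsNegInvariant]

/-- **Young `L¹ × Lᵖ → Lᵖ` in `lintegral` form**: for nonnegative measurable `K`, `g` and
`1 ≤ p`, `∫ (∫ K(x - y) g(y) dy)^p dx ≤ (∫ K)^p ∫ g^p` (Jensen/Hölder in `y` with the probability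
weight `K/‖K‖₁`, then Tonelli and translation invariance). [folklore] -/
theorem lintegral_rpow_lintegral_sub_mul_le {K g : E → ℝ≥0∞} (hK : Measurable K)
    (hg : Measurable g) {p : ℝ} (hp : 1 ≤ p) :
    ∫⁻ x, (∫⁻ y, K (x - y) * g y ∂μ) ^ p ∂μ ≤ (∫⁻ y, K y ∂μ) ^ p * ∫⁻ x, g x ^ p ∂μ := by
  set A := ∫⁻ y, K y ∂μ with hA
  have hswap : ∀ x, ∫⁻ y, K (x - y) * g y ∂μ = ∫⁻ y, K y * g (x - y) ∂μ := fun x => by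
    have h := lintegral_sub_left_eq_self (μ := μ) (fun y => K y * g (x - y)) x
    simp only [sub_sub_cancel] at h
    exact h
  simp_rw [hswap]
  have hG : Measurable (fun z : E × E => K z.2 * g (z.1 - z.2) ^ p) :=
    (hK.comp measurable_snd).mul ((hg.comp (measurable_fst.sub measurable_snd)).pow_const _)
  calc ∫⁻ x, (∫⁻ y, K y * g (x - y) ∂μ) ^ p ∂μ
      ≤ ∫⁻ x, A ^ (p - 1) * ∫⁻ y, K y * g (x - y) ^ p ∂μ ∂μ :=
        lintegral_mono fun x => UnboundedOperators.lintegral_mul_rpow_le_of_one_le hK.aemeasurable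
          ((hg.comp (measurable_const.sub measurable_id)).aemeasurable) hp
    _ = A ^ (p - 1) * ∫⁻ y, ∫⁻ x, K y * g (x - y) ^ p ∂μ ∂μ := by
        rw [lintegral_const_mul'' _ hG.aemeasurable.lintegral_prod_right',
          lintegral_lintegral_swap hG.aemeasurable]
    _ = A ^ (p - 1) * ∫⁻ y, K y * ∫⁻ x, g x ^ p ∂μ ∂μ := by
        congr 1
        refine lintegral_congr fun y => ?_
        have hgy : AEMeasurable (fun x => g (x - y) ^ p) μ :=
          ((hg.comp (measurable_id.sub_const y)).pow_const _).aemeasurable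
        rw [lintegral_const_mul'' _ hgy, lintegral_sub_right_eq_self (fun x => g x ^ p) y]
    _ = A ^ p * ∫⁻ x, g x ^ p ∂μ := by
        rw [lintegral_mul_const'' _ hK.aemeasurable, ← mul_assoc, ← hA]
        congr 1
        conv_rhs => rw [← sub_add_cancel p 1, ENNReal.rpow_add_of_nonneg _ _ (by linarith)
          zero_le_one, ENNReal.rpow_one]

end Young

/-! ### `Lᵖ` bounds for `heatDivTensor` -/

section LpBounds

variable {E : Type*} [NormedAddCommGroup E] [InnerProductSpace ℝ E] [FiniteDimensional ℝ E]
  [MeasurableSpace E] [BorelSpace E]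
variable {F : Type*} [NormedAddCommGroup F] [NormedSpace ℝ F]

omit [FiniteDimensional ℝ E] [MeasurableSpace E] [BorelSpace E] in
/-- The integrand of `heatDivTensor` through the explicit gradient of the Gauss–Weierstrass
kernel: `(DG_τ)(x - y)[v y] • w y = (-(G_τ(x - y)/(2τ)) ⟪x - y, v y⟫) • w y`. [folklore] -/
theorem heatDivTensor_integrand_eq (τ : ℝ) (v : E → E) (w : E → F) (x y : E) :
    (fderiv ℝ (UnboundedOperators.heatKernel (E := E) τ) (x - y) (v y)) • w y =
      (-(UnboundedOperators.heatKernel τ (x - y) / (2 * τ)) * ⟪x - y, v y⟫) • w y := by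
  rw [UnboundedOperators.fderiv_heatKernel_apply_eq_mul_inner]

/-- The integrand of `heatDivTensor σ v w x`, as a function of `(x, y)`, is a.e. strongly
measurable on `E × E` for a.e. strongly measurable `v`, `w`. [folklore] -/
theorem aestronglyMeasurable_heatDivTensor_integrand {v : E → E} {w : E → F}
    (hv : AEStronglyMeasurable v volume) (hw : AEStronglyMeasurable w volume) (τ : ℝ) :
    AEStronglyMeasurable
      (fun z : E × E => (fderiv ℝ (UnboundedOperators.heatKernel (E := E) τ) (z.1 - z.2) (v z.2)) • w z.2)
      (volume.prod volume) := by
  have h1 : AEStronglyMeasurable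
      (fun z : E × E => -(UnboundedOperators.heatKernel τ (z.1 - z.2) / (2 * τ)) * ⟪z.1 - z.2, v z.2⟫)
      (volume.prod volume) := by
    have hc : Continuous fun z : E × E => -(UnboundedOperators.heatKernel τ (z.1 - z.2) / (2 * τ)) :=
      (((UnboundedOperators.continuous_heatKernel τ).comp (continuous_fst.sub continuous_snd)).div_const
        _).neg
    exact hc.aestronglyMeasurable.mul ((continuous_fst.sub continuous_snd).aestronglyMeasurable.inner
      hv.comp_snd)
  refine (h1.smul hw.comp_snd).congr (Eventually.of_forall fun z => ?_)
  exact (heatDivTensor_integrand_eq τ v w z.1 z.2).symm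

/-- `heatDivTensor σ v w` is a.e. strongly measurable for a.e. strongly measurable `v`, `w`
(a parametric Bochner integral of a jointly measurable integrand). [folklore] -/
theorem aestronglyMeasurable_heatDivTensor {v : E → E} {w : E → F}
    (hv : AEStronglyMeasurable v volume) (hw : AEStronglyMeasurable w volume) (τ : ℝ) :
    AEStronglyMeasurable (heatDivTensor τ v w) volume :=
  (aestronglyMeasurable_heatDivTensor_integrand hv hw τ).integral_prod_right'

omit [FiniteDimensional ℝ E] [MeasurableSpace E] [BorelSpace E] in
/-- Pointwise bound on the integrand: `‖(DG_τ)(x - y)[v y] • w y‖ ≤ C ‖DG_τ(x - y)‖ ‖w y‖` when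
`‖v y‖ ≤ C`. [folklore] -/
theorem norm_heatDivTensor_integrand_le {v : E → E} {C : ℝ} {y : E} (hy : ‖v y‖ ≤ C) (w : E → F)
    (τ : ℝ) (x : E) :
    ‖(fderiv ℝ (UnboundedOperators.heatKernel (E := E) τ) (x - y) (v y)) • w y‖ ≤
      C * ‖fderiv ℝ (UnboundedOperators.heatKernel (E := E) τ) (x - y)‖ * ‖w y‖ := by
  rw [norm_smul]
  refine mul_le_mul_of_nonneg_right ?_ (norm_nonneg _)
  calc ‖fderiv ℝ (UnboundedOperators.heatKernel τ) (x - y) (v y)‖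
      ≤ ‖fderiv ℝ (UnboundedOperators.heatKernel τ) (x - y)‖ * ‖v y‖ := ContinuousLinearMap.le_opNorm _ _
    _ ≤ ‖fderiv ℝ (UnboundedOperators.heatKernel τ) (x - y)‖ * C :=
        mul_le_mul_of_nonneg_left hy (norm_nonneg _)
    _ = C * ‖fderiv ℝ (UnboundedOperators.heatKernel τ) (x - y)‖ := mul_comm _ _

/-- **Pointwise bound** `‖e^{τΔ} div (v ⊗ w)(x)‖ ≤ C ∫ ‖∇G_τ(x - y)‖ ‖w y‖ dy` (in `ℝ≥0∞`) when
`‖v‖ ≤ C` a.e. [folklore] -/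
theorem enorm_heatDivTensor_le {v : E → E} {C : ℝ} (hC : ∀ᵐ y ∂(volume : Measure E), ‖v y‖ ≤ C)
    (w : E → F) (τ : ℝ) (x : E) :
    ‖heatDivTensor τ v w x‖ₑ ≤
      ENNReal.ofReal C * ∫⁻ y, ‖fderiv ℝ (UnboundedOperators.heatKernel (E := E) τ) (x - y)‖ₑ * ‖w y‖ₑ := by
  unfold heatDivTensor
  calc ‖∫ y, (fderiv ℝ (UnboundedOperators.heatKernel (E := E) τ) (x - y) (v y)) • w y‖ₑ
      ≤ ∫⁻ y, ‖(fderiv ℝ (UnboundedOperators.heatKernel (E := E) τ) (x - y) (v y)) • w y‖ₑ :=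
        enorm_integral_le_lintegral_enorm _
    _ ≤ ∫⁻ y, ENNReal.ofReal C *
          (‖fderiv ℝ (UnboundedOperators.heatKernel (E := E) τ) (x - y)‖ₑ * ‖w y‖ₑ) := by
        refine lintegral_mono_ae (hC.mono fun y hy => ?_)
        rw [← ofReal_norm, ← ofReal_norm, ← ofReal_norm, ← ENNReal.ofReal_mul (norm_nonneg _),
          ← ENNReal.ofReal_mul ((le_trans (norm_nonneg _) hy)), ← mul_assoc]
        exact ENNReal.ofReal_le_ofReal (norm_heatDivTensor_integrand_le hy w τ x)
    _ = _ := lintegral_const_mul' _ _ ENNReal.ofReal_ne_top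

/-- **Young bound for `e^{τΔ} div (v ⊗ w)`**: `‖heatDivTensor τ v w‖_p ≤ C 2^{n/2} τ^{-1/2} ‖w‖_p`
for `‖v‖ ≤ C` a.e., `w` a.e. strongly measurable, `0 < τ`, `1 ≤ p < ∞` (`n = dim E`;
Giga–Giga–Saal 2010, §1.1.3 for `‖∇e^{tΔ}‖_{L¹→L¹} ≲ t^{-1/2}`; Kato 1984, (2.3')). [cite: Kato1984, (1.7)] -/
theorem eLpNorm_heatDivTensor_le {v : E → E} {C : ℝ} (hC0 : 0 ≤ C)
    (hC : ∀ᵐ y ∂(volume : Measure E), ‖v y‖ ≤ C) {w : E → F} (hw : AEStronglyMeasurable w volume)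
    {τ : ℝ} (hτ : 0 < τ) {p : ℝ≥0∞} (hp : 1 ≤ p) (hp' : p ≠ ∞) :
    eLpNorm (heatDivTensor τ v w) p volume ≤
      ENNReal.ofReal (C * ((2 : ℝ) ^ ((Module.finrank ℝ E : ℝ) / 2) * τ ^ (-(1 / 2 : ℝ)))) *
        eLpNorm w p volume := by
  have hp0 : p ≠ 0 := (zero_lt_one.trans_le hp).ne'
  have hpr : 1 ≤ p.toReal := by
    simpa using (ENNReal.toReal_le_toReal ENNReal.one_ne_top hp').2 hp
  have hpr0 : 0 < p.toReal := one_pos.trans_le hpr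
  -- the scalar kernel `‖∇G_τ‖` and the density `‖w‖`
  set K : E → ℝ≥0∞ := fun z => ‖fderiv ℝ (UnboundedOperators.heatKernel (E := E) τ) z‖ₑ with hK
  have hKm : Measurable K := (UnboundedOperators.continuous_fderiv_heatKernel τ).measurable.enorm
  set g : E → ℝ≥0∞ := fun y => ‖hw.mk w y‖ₑ with hg
  have hgm : Measurable g := hw.stronglyMeasurable_mk.enorm
  have hwg : ∀ᵐ y ∂(volume : Measure E), ‖w y‖ₑ = g y := by
    filter_upwards [hw.ae_eq_mk] with y hy
    rw [hg, hy]
  set A : ℝ≥0∞ := ∫⁻ y, K y with hA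
  have hAle : A ≤ ENNReal.ofReal ((2 : ℝ) ^ ((Module.finrank ℝ E : ℝ) / 2) * τ ^ (-(1 / 2 : ℝ))) :=
    UnboundedOperators.lintegral_enorm_fderiv_heatKernel_le hτ
  -- pointwise bound with the measurable modification of `w`
  have hpt : ∀ x, ‖heatDivTensor τ v w x‖ₑ ≤ ENNReal.ofReal C * ∫⁻ y, K (x - y) * g y := fun x => by
    refine (enorm_heatDivTensor_le hC w τ x).trans_eq ?_
    congr 1
    refine lintegral_congr_ae ?_
    filter_upwards [hwg] with y hy
    rw [hy]
  -- `p`-th powers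
  have hmain : ∫⁻ x, ‖heatDivTensor τ v w x‖ₑ ^ p.toReal ≤
      (ENNReal.ofReal C * A) ^ p.toReal * ∫⁻ x, ‖w x‖ₑ ^ p.toReal := by
    calc ∫⁻ x, ‖heatDivTensor τ v w x‖ₑ ^ p.toReal
        ≤ ∫⁻ x, (ENNReal.ofReal C * ∫⁻ y, K (x - y) * g y) ^ p.toReal :=
          lintegral_mono fun x => ENNReal.rpow_le_rpow (hpt x) hpr0.le
      _ = (ENNReal.ofReal C) ^ p.toReal * ∫⁻ x, (∫⁻ y, K (x - y) * g y) ^ p.toReal := by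
          simp_rw [ENNReal.mul_rpow_of_nonneg _ _ hpr0.le]
          rw [lintegral_const_mul' _ _ (ENNReal.rpow_ne_top_of_nonneg hpr0.le ENNReal.ofReal_ne_top)]
      _ ≤ (ENNReal.ofReal C) ^ p.toReal * (A ^ p.toReal * ∫⁻ x, g x ^ p.toReal) :=
          mul_le_mul' le_rfl (lintegral_rpow_lintegral_sub_mul_le hKm hgm hpr)
      _ = (ENNReal.ofReal C * A) ^ p.toReal * ∫⁻ x, ‖w x‖ₑ ^ p.toReal := by
          rw [ENNReal.mul_rpow_of_nonneg _ _ hpr0.le, mul_assoc]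
          congr 2
          refine lintegral_congr_ae ?_
          filter_upwards [hwg] with y hy
          rw [hy]
  rw [eLpNorm_eq_lintegral_rpow_enorm_toReal hp0 hp', eLpNorm_eq_lintegral_rpow_enorm_toReal hp0 hp']
  calc (∫⁻ x, ‖heatDivTensor τ v w x‖ₑ ^ p.toReal) ^ (1 / p.toReal)
      ≤ ((ENNReal.ofReal C * A) ^ p.toReal * ∫⁻ x, ‖w x‖ₑ ^ p.toReal) ^ (1 / p.toReal) :=
        ENNReal.rpow_le_rpow hmain (by positivity)
    _ = ENNReal.ofReal C * A * (∫⁻ x, ‖w x‖ₑ ^ p.toReal) ^ (1 / p.toReal) := by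
        rw [ENNReal.mul_rpow_of_nonneg _ _ (by positivity), ← ENNReal.rpow_mul,
          mul_one_div_cancel hpr0.ne', ENNReal.rpow_one]
    _ ≤ ENNReal.ofReal C * ENNReal.ofReal ((2 : ℝ) ^ ((Module.finrank ℝ E : ℝ) / 2) *
          τ ^ (-(1 / 2 : ℝ))) * (∫⁻ x, ‖w x‖ₑ ^ p.toReal) ^ (1 / p.toReal) := by
        gcongr
    _ = _ := by rw [← ENNReal.ofReal_mul hC0]

/-- **`e^{τΔ} div (v ⊗ w) ∈ Lᵖ`** for `v` a.e. strongly measurable with `‖v‖ ≤ C` a.e., `w ∈ Lᵖ`,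
`0 < τ`, `1 ≤ p < ∞` (Kato 1984, (2.3'); Giga–Giga–Saal 2010, §1.1.3). [cite: Kato1984, (1.7)] -/
theorem memLp_heatDivTensor {v : E → E} (hv : AEStronglyMeasurable v volume) {C : ℝ}
    (hC : ∀ᵐ y ∂(volume : Measure E), ‖v y‖ ≤ C) {w : E → F} {p : ℝ≥0∞} (hw : MemLp w p volume)
    {τ : ℝ} (hτ : 0 < τ) (hp : 1 ≤ p) (hp' : p ≠ ∞) :
    MemLp (heatDivTensor τ v w) p volume := by
  have hC' : ∀ᵐ y ∂(volume : Measure E), ‖v y‖ ≤ max C 0 := hC.mono fun y hy => hy.trans (le_max_left _ _)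
  refine ⟨aestronglyMeasurable_heatDivTensor hv hw.1 τ, ?_⟩
  refine (eLpNorm_heatDivTensor_le (le_max_right C 0) hC' hw.1 hτ hp hp').trans_lt ?_
  exact ENNReal.mul_lt_top ENNReal.ofReal_lt_top hw.eLpNorm_lt_top

end LpBounds

/-! ### The pairing identity `∫ ⟪e^{σΔ} div (v ⊗ w), φ⟫ = -∫ ⟪w, (v·∇) e^{σΔ}φ⟫` -/

section Pairing

variable {E : Type*} [NormedAddCommGroup E] [InnerProductSpace ℝ E] [FiniteDimensional ℝ E]
  [MeasurableSpace E] [BorelSpace E]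
variable {F' : Type*} [NormedAddCommGroup F'] [InnerProductSpace ℝ F']

/-- **The derivative of the caloric extension, tested from the left**: for `φ ∈ L²`, `0 < τ` and
fixed `e`, `∫ (DG_τ)(x - y)[e] • φ x dx = -∂ₑ(e^{τΔ}φ)(y)` (the derivative of `e^{τΔ}φ` is the
convolution with the *odd* kernel `∂ₑG_τ`; Lemarié-Rieusset 2016, §6.2). [folklore] -/
theorem integral_fderiv_heatKernel_sub_smul_eq {φ : E → F'} (hφ : MemLp φ 2 volume) {τ : ℝ}
    (hτ : 0 < τ) (y e : E) :
    ∫ x, (fderiv ℝ (UnboundedOperators.heatKernel (E := E) τ) (x - y) e) • φ x =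
      -fderiv ℝ (UnboundedOperators.heatExtension φ τ) y e := by
  rw [UnboundedOperators.fderiv_heatExtension_apply_eq_convolution hφ one_le_two hτ y e,
    convolution_eq_swap, ← integral_neg]
  refine integral_congr_ae (Eventually.of_forall fun x => ?_)
  simp only [ContinuousLinearMap.lsmul_apply]
  have h : y - x = -(x - y) := (neg_sub x y).symm
  rw [h, UnboundedOperators.fderiv_heatKernel_neg_apply, neg_smul, neg_neg]

/-- Integrability of `x ↦ (DG_τ)(x - y)[e] • φ x` for `φ ∈ L²` (`∂G_τ ∈ L²`). [folklore] -/
theorem integrable_fderiv_heatKernel_sub_smul {φ : E → F'} (hφ : MemLp φ 2 volume) {τ : ℝ}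
    (hτ : 0 < τ) (y e : E) :
    Integrable (fun x => (fderiv ℝ (UnboundedOperators.heatKernel (E := E) τ) (x - y) e) • φ x) := by
  have hk : MemLp (fun x => fderiv ℝ (UnboundedOperators.heatKernel (E := E) τ) (x - y) e) 2 volume :=
    (UnboundedOperators.memLp_fderiv_heatKernel_apply hτ e 2).comp_measurePreserving
      (measurePreserving_sub_right volume y)
  exact memLp_one_iff_integrable.1 (hφ.smul hk)

/-- Integrability in `y` of the `heatDivTensor` integrand at a fixed `x`, for bounded `v` and
`w ∈ L²` (`∇G_τ(x - ·) ∈ L²`). [folklore] -/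
theorem integrable_heatDivTensor_integrand {v : E → E} (hv : AEStronglyMeasurable v volume) {C : ℝ}
    (hC : ∀ᵐ y ∂(volume : Measure E), ‖v y‖ ≤ C) {w : E → F'} (hw : MemLp w 2 volume) {τ : ℝ}
    (hτ : 0 < τ) (x : E) :
    Integrable (fun y => (fderiv ℝ (UnboundedOperators.heatKernel (E := E) τ) (x - y) (v y)) • w y) := by
  -- majorant `C ‖∇G_τ(x - y)‖ ‖w y‖`
  have hk : MemLp (fun y => ‖fderiv ℝ (UnboundedOperators.heatKernel (E := E) τ) (x - y)‖) 2 volume := by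
    have h1 : MemLp (fun z : E => ‖fderiv ℝ (UnboundedOperators.heatKernel (E := E) τ) z‖) 2 volume := by
      have hb : 0 < 1 / (8 * τ) := by positivity
      refine ((UnboundedOperators.memLp_gaussian_of_pos (E := E) hb 2).const_mul
        ((4 * Real.pi * τ) ^ (-(Module.finrank ℝ E : ℝ) / 2) * (Real.sqrt τ)⁻¹)).of_le
        (UnboundedOperators.continuous_fderiv_heatKernel τ).norm.aestronglyMeasurable
        (Eventually.of_forall fun z => ?_)
      rw [norm_norm]
      exact (UnboundedOperators.norm_fderiv_heatKernel_le hτ z).trans (Real.le_norm_self _)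
    exact h1.comp_measurePreserving (Measure.measurePreserving_sub_left volume x)
  have hmaj : Integrable (fun y => C * (‖fderiv ℝ (UnboundedOperators.heatKernel (E := E) τ) (x - y)‖ *
      ‖w y‖)) := (memLp_one_iff_integrable.1 (hw.norm.mul' hk)).const_mul C
  have hmeas : AEStronglyMeasurable
      (fun y => (fderiv ℝ (UnboundedOperators.heatKernel (E := E) τ) (x - y) (v y)) • w y) volume := by
    have h1 : AEStronglyMeasurable
        (fun y => -(UnboundedOperators.heatKernel τ (x - y) / (2 * τ)) * ⟪x - y, v y⟫) volume := by
      have hc : Continuous fun y : E => -(UnboundedOperators.heatKernel τ (x - y) / (2 * τ)) :=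
        (((UnboundedOperators.continuous_heatKernel τ).comp (continuous_const.sub continuous_id)).div_const
          _).neg
      exact hc.aestronglyMeasurable.mul ((continuous_const.sub continuous_id).aestronglyMeasurable.inner hv)
    refine (h1.smul hw.1).congr (Eventually.of_forall fun y => ?_)
    exact (heatDivTensor_integrand_eq τ v w x y).symm
  refine hmaj.mono' hmeas ?_
  filter_upwards [hC] with y hy
  calc ‖(fderiv ℝ (UnboundedOperators.heatKernel (E := E) τ) (x - y) (v y)) • w y‖
      ≤ C * ‖fderiv ℝ (UnboundedOperators.heatKernel (E := E) τ) (x - y)‖ * ‖w y‖ :=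
        norm_heatDivTensor_integrand_le hy w τ x
    _ = C * (‖fderiv ℝ (UnboundedOperators.heatKernel (E := E) τ) (x - y)‖ * ‖w y‖) := mul_assoc _ _ _

/-- Integrability on `E × E` of the tested `heatDivTensor` integrand
`(x, y) ↦ ⟪(DG_τ)(x - y)[v y] • w y, φ x⟫` for bounded `v` and `w, φ ∈ L²` (majorant
`C |∇G_τ(x - y)| ‖w y‖ ‖φ x‖`, integrable by Young and Hölder: tree `integrable_kernel_mul_mul`).
[folklore] -/
theorem integrable_inner_heatDivTensor_integrand {v : E → E} (hv : AEStronglyMeasurable v volume)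
    {C : ℝ} (hC : ∀ᵐ y ∂(volume : Measure E), ‖v y‖ ≤ C) {w φ : E → F'} (hw : MemLp w 2 volume)
    (hφ : MemLp φ 2 volume) {τ : ℝ} (hτ : 0 < τ) :
    Integrable (fun z : E × E =>
      ⟪φ z.1, (fderiv ℝ (UnboundedOperators.heatKernel (E := E) τ) (z.1 - z.2) (v z.2)) • w z.2⟫)
      (volume.prod volume) := by
  set k : E → ℝ := fun z => ‖fderiv ℝ (UnboundedOperators.heatKernel (E := E) τ) z‖ with hk
  have hk1 : Integrable k := by
    have hb : 0 < 1 / (8 * τ) := by positivity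
    refine ((UnboundedOperators.integrable_gaussian_of_pos (E := E) hb).const_mul
      ((4 * Real.pi * τ) ^ (-(Module.finrank ℝ E : ℝ) / 2) * (Real.sqrt τ)⁻¹)).mono'
      (UnboundedOperators.continuous_fderiv_heatKernel τ).norm.aestronglyMeasurable
      (Eventually.of_forall fun z => ?_)
    rw [hk, norm_norm]
    exact UnboundedOperators.norm_fderiv_heatKernel_le hτ z
  have hk2 : MemLp k 2 volume := by
    have hb : 0 < 1 / (8 * τ) := by positivity
    refine ((UnboundedOperators.memLp_gaussian_of_pos (E := E) hb 2).const_mul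
      ((4 * Real.pi * τ) ^ (-(Module.finrank ℝ E : ℝ) / 2) * (Real.sqrt τ)⁻¹)).of_le
      (UnboundedOperators.continuous_fderiv_heatKernel τ).norm.aestronglyMeasurable
      (Eventually.of_forall fun z => ?_)
    rw [hk, norm_norm]
    exact (UnboundedOperators.norm_fderiv_heatKernel_le hτ z).trans (Real.le_norm_self _)
  have hmaj := (UnboundedOperators.integrable_kernel_mul_mul hk1 (p := 2) (q := 2) hk2 hw.norm
    hφ.norm).const_mul C
  have hmeas : AEStronglyMeasurable (fun z : E × E =>
      ⟪φ z.1, (fderiv ℝ (UnboundedOperators.heatKernel (E := E) τ) (z.1 - z.2) (v z.2)) • w z.2⟫)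
      (volume.prod volume) :=
    hφ.1.comp_fst.inner (aestronglyMeasurable_heatDivTensor_integrand hv hw.1 τ)
  refine hmaj.mono' hmeas ?_
  have hC' : ∀ᵐ z : E × E ∂(volume.prod volume), ‖v z.2‖ ≤ C :=
    Measure.quasiMeasurePreserving_snd.ae hC
  filter_upwards [hC'] with z hz
  calc ‖⟪φ z.1, (fderiv ℝ (UnboundedOperators.heatKernel (E := E) τ) (z.1 - z.2) (v z.2)) • w z.2⟫‖
      ≤ ‖φ z.1‖ * ‖(fderiv ℝ (UnboundedOperators.heatKernel (E := E) τ) (z.1 - z.2) (v z.2)) • w z.2‖ :=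
        norm_inner_le_norm _ _
    _ ≤ ‖φ z.1‖ * (C * ‖fderiv ℝ (UnboundedOperators.heatKernel (E := E) τ) (z.1 - z.2)‖ * ‖w z.2‖) :=
        mul_le_mul_of_nonneg_left (norm_heatDivTensor_integrand_le hz w τ z.1) (norm_nonneg _)
    _ = C * (k (z.1 - z.2) * ‖w z.2‖ * ‖φ z.1‖) := by rw [hk]; ring

/-- **Pairing identity for the heat-smoothed nonlinearity** (the tested form of
`e^{τΔ} div (v ⊗ w)`): for `v` a.e. strongly measurable and a.e. bounded, `w, φ ∈ L²(E; F')` and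
`0 < τ`,
`∫ ⟪heatDivTensor τ v w x, φ x⟫ dx = -∫ ⟪w y, D(e^{τΔ}φ)(y)[v y]⟫ dy = -∫ ⟪w, (v·∇) e^{τΔ}φ⟫`
(Fubini on `E × E`; the inner `x`-integral is `-∂_{v y}(e^{τΔ}φ)(y)` because `∇G_τ` is odd).
This is the computation `⟨e^{τΔ} div (u ⊗ u), φ⟩ = -⟨u ⊗ u, ∇ e^{τΔ}φ⟩` behind the equivalence
of the Duhamel formula with the duality ("very weak") formulation (Fabes–Jones–Rivière 1972,
Thm. 2.1; Lemarié-Rieusset 2016, Thm. 6.1). [cite: LemarieRieusset2016, Thm. 6.1] -/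
theorem integral_inner_heatDivTensor_eq [CompleteSpace F'] {v : E → E} (hv : AEStronglyMeasurable v volume) {C : ℝ}
    (hC : ∀ᵐ y ∂(volume : Measure E), ‖v y‖ ≤ C) {w φ : E → F'} (hw : MemLp w 2 volume)
    (hφ : MemLp φ 2 volume) {τ : ℝ} (hτ : 0 < τ) :
    ∫ x, ⟪heatDivTensor τ v w x, φ x⟫ =
      -∫ y, ⟪w y, fderiv ℝ (UnboundedOperators.heatExtension φ τ) y (v y)⟫ := by
  -- Step 1: move `φ x` inside the `y`-integral (`integral_inner` has the constant on the left)
  have h1 : ∀ x, ⟪heatDivTensor τ v w x, φ x⟫ =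
      ∫ y, ⟪φ x, (fderiv ℝ (UnboundedOperators.heatKernel (E := E) τ) (x - y) (v y)) • w y⟫ := fun x => by
    unfold heatDivTensor
    rw [integral_inner (integrable_heatDivTensor_integrand hv hC hw hτ x) (φ x), real_inner_comm]
  simp_rw [h1]
  -- Step 2: Fubini
  rw [integral_integral_swap (integrable_inner_heatDivTensor_integrand hv hC hw hφ hτ), ← integral_neg]
  refine integral_congr_ae (Eventually.of_forall fun y => ?_)
  -- Step 3: the inner `x`-integral
  have h3 : ∀ x, ⟪φ x, (fderiv ℝ (UnboundedOperators.heatKernel (E := E) τ) (x - y) (v y)) • w y⟫ =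
      ⟪w y, (fderiv ℝ (UnboundedOperators.heatKernel (E := E) τ) (x - y) (v y)) • φ x⟫ := fun x => by
    rw [real_inner_smul_right, real_inner_smul_right, real_inner_comm]
  simp_rw [h3]
  rw [integral_inner (integrable_fderiv_heatKernel_sub_smul hφ hτ y (v y)) (w y),
    integral_fderiv_heatKernel_sub_smul_eq hφ hτ y (v y), inner_neg_right]

end Pairing

/-! ### Joint measurability of `heatDivTensor` with measurably varying data and times -/

section Param

variable {E : Type*} [NormedAddCommGroup E] [InnerProductSpace ℝ E] [FiniteDimensional ℝ E]
  [MeasurableSpace E] [BorelSpace E]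
variable {F : Type*} [NormedAddCommGroup F] [NormedSpace ℝ F]
variable {P : Type*} [MeasurableSpace P] {μ : Measure P} [SFinite μ]

omit [FiniteDimensional ℝ E] in
/-- `(t, z) ↦ G_t(z)` is jointly measurable (a private copy of the tree's
`measurable_heatKernel_uncurry` of `KochTataruKernel.lean`, not imported here to keep the import
closure small). [folklore] -/
private theorem measurable_heatKernel_uncurry' :
    Measurable (fun q : ℝ × E => UnboundedOperators.heatKernel q.1 q.2) := by
  unfold UnboundedOperators.heatKernel
  fun_prop

/-- **Joint measurability of `(p, x) ↦ e^{c(p)Δ} div (V_p ⊗ W_p)(x)`** for jointly (a.e. strongly)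
measurable data `V, W` on `P × E` and measurable times `c : P → ℝ`: the integrand
`((p, x), y) ↦ (DG_{c p})(x - y)[V(p, y)] • W(p, y)` is a.e. strongly measurable on `(P × E) × E`,
and parametric Bochner integrals of such integrands are a.e. strongly measurable. [folklore] -/
theorem aestronglyMeasurable_heatDivTensor_param {c : P → ℝ} (hc : Measurable c) {V : P × E → E}
    {W : P × E → F} (hV : AEStronglyMeasurable V (μ.prod (volume : Measure E)))
    (hW : AEStronglyMeasurable W (μ.prod (volume : Measure E))) :
    AEStronglyMeasurable
      (fun q : P × E => heatDivTensor (c q.1) (fun y => V (q.1, y)) (fun y => W (q.1, y)) q.2)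
      (μ.prod volume) := by
  -- the integrand on `(P × E) × E`, in explicit form
  have hproj := quasiMeasurePreserving_proj_param (P := P) (μ := μ) (E := E)
  have hVr : AEStronglyMeasurable (fun r : (P × E) × E => V (r.1.1, r.2))
      ((μ.prod (volume : Measure E)).prod (volume : Measure E)) := hV.comp_quasiMeasurePreserving hproj
  have hWr : AEStronglyMeasurable (fun r : (P × E) × E => W (r.1.1, r.2))
      ((μ.prod (volume : Measure E)).prod (volume : Measure E)) := hW.comp_quasiMeasurePreserving hproj
  have hscal : Measurable (fun r : (P × E) × E =>
      -(UnboundedOperators.heatKernel (c r.1.1) (r.1.2 - r.2) / (2 * c r.1.1))) := by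
    have h1 : Measurable (fun r : (P × E) × E => UnboundedOperators.heatKernel (c r.1.1) (r.1.2 - r.2)) :=
      measurable_heatKernel_uncurry'.comp ((hc.comp (measurable_fst.comp measurable_fst)).prodMk
        ((measurable_snd.comp measurable_fst).sub measurable_snd))
    exact (h1.div (measurable_const.mul (hc.comp (measurable_fst.comp measurable_fst)))).neg
  have hinner : AEStronglyMeasurable (fun r : (P × E) × E => ⟪r.1.2 - r.2, V (r.1.1, r.2)⟫)
      ((μ.prod (volume : Measure E)).prod (volume : Measure E)) :=
    ((measurable_snd.comp measurable_fst).sub measurable_snd).aestronglyMeasurable.inner hVr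
  have hI : AEStronglyMeasurable (fun r : (P × E) × E =>
      (fderiv ℝ (UnboundedOperators.heatKernel (E := E) (c r.1.1)) (r.1.2 - r.2) (V (r.1.1, r.2))) •
        W (r.1.1, r.2)) ((μ.prod (volume : Measure E)).prod (volume : Measure E)) := by
    refine ((hscal.aestronglyMeasurable.mul hinner).smul hWr).congr (Eventually.of_forall fun r => ?_)
    exact (heatDivTensor_integrand_eq (c r.1.1) (fun y => V (r.1.1, y)) (fun y => W (r.1.1, y))
      r.1.2 r.2).symm
  exact hI.integral_prod_right'

end Param

end Literature.Analysis.FluidPDE
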